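import Mathlib.Algebra.MvPolynomial.Funext
import Mathlib.Data.Nat.Choose.Multinomial
import Mathlib.LinearAlgebra.Dual.Lemmas
import Mathlib.LinearAlgebra.Finsupp.LinearCombination
import Mathlib.FieldTheory.IsAlgClosed.Basic
import Mathlib.Algebra.CharZero.Infinite
import Literature.Computability.AlgebraicComplexity.OrbitCoordinateRing
import HarnessLib

/-!
# Nonvanishing of forms on power sums with few terms (BIP 2019, §3(a): Lemma 3.1, Prop. 3.2)

Bürgisser–Ikenmeyer–Panova, *No occurrence obstructions in geometric complexity theory*,
J. AMS 32 (2019) = arXiv:1604.06431v3, §3(a):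

* Lemma 3.1: "Let `W` be a finite dimensional `ℂ`-vector space and let `p ∈ Sym^d W^*` such that
  `⟨p, (∑_{j=1}^r w_j)^d⟩ ≠ 0` for some `w_1, …, w_r ∈ W`. Then there exists `J ⊆ [r]` with
  `|J| ≤ d` and `⟨p, (∑_{j∈J} w_j)^d⟩ ≠ 0`."
* Prop. 3.2: "Let `V` be a finite dimensional `ℂ`-vector space and `d, n ≥ 1`. If
  `f ∈ Sym^d Sym^n V` is nonzero, then `⟨f, (φ_1^n + ⋯ + φ_d^n)^d⟩ ≠ 0` for Zariski almost all
  `(φ_1, …, φ_d) ∈ (V^*)^d`. This means that `f`, viewed as a homogeneous polynomial function of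
  degree `d` on `Sym^n V^*`, does not vanish on almost all power sums `φ_1^n + ⋯ + φ_d^n` with
  `d` terms." Its proof uses that `Sym^n V^*` is spanned by `n`-th powers of linear forms
  ("There exist `r ∈ ℕ` and `ψ_1, …, ψ_r ∈ V^*` such that `w = ψ_1^n + … + ψ_r^n`").

Prop. 3.2 is the ingredient of BIP's proofs of Props. 2.3, 2.4, 6.1 and Thm. 6.2 that produces
the power sums on which highest-weight vectors are evaluated (combined with Thm. 2.5, padded power
sums lie in `Ω_n`, proved in `PaddedPowerSums.lean`).

This file PROVES these statements in G20's coordinates (`formCoeff n q : DegIdx σ n → k` the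
degree-`n` coefficient vector of `q ∈ k[x_σ]`, a "polynomial function of degree `d` on
`Sym^n V^*`" being `F : MvPolynomial (DegIdx σ n) k` of total degree `≤ d`, evaluated by `aeval`):

* `exists_card_le_and_eval_sum_smul_ne_zero` — Lemma 3.1 over any infinite field, for
  polynomials of degree `≤ r` (not necessarily homogeneous) and with coefficients `t_j`
  (BIP: `t_j ∈ {0,1}` via the polarization formula; here instead: `G(t) = F(∑_j t_j w_j)` is a
  nonzero polynomial of degree `≤ r`, so has a monomial in at most `r` of the `t_j`, and its part
  in those variables is a nonzero polynomial);
* `span_range_formCoeff_linearFormPow_eq_top` — the `n`-th powers of linear forms span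
  `Sym^n V^*` in characteristic zero (a functional vanishing on all `(∑_x t_x X_x)^n` has the
  polynomial `∑_β L_β multinomial(β) t^β` vanishing identically; `coeff_linearFormPow` is the
  multinomial expansion);
* `exists_aeval_formCoeff_sum_C_mul_linearFormPow_ne_zero` — Prop. 3.2 over any field of
  characteristic zero with coefficients: `F ≠ 0` of degree `≤ r` does not vanish at some
  `∑_{i<r} a_i φ_i^n`;
* `exists_aeval_formCoeff_sum_linearFormPow_ne_zero` — Prop. 3.2 as printed (`n ≥ 1`,
  algebraically closed field of characteristic zero: the `a_i` are `n`-th powers);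
* `exists_aeval_formCoeff_sum_linearFormPow_ne_zero_and` — the "Zariski almost all" content in
  the form used by BIP's proof of Prop. 6.1: two nonzero forms have a common good power sum
  (via the generic power sum `∑_i (∑_x Y_{(i,x)} X_x)^n`, `eval_aeval_coeff_genericPowerSum`).

## References

* P. Bürgisser, C. Ikenmeyer, G. Panova, J. AMS 32 (2019) = arXiv:1604.06431v3, §3(a),
  Lemma 3.1, Prop. 3.2 (key `BurgisserIkenmeyerPanovaJAMS2019`).
* J. M. Landsberg, *Geometry and Complexity Theory*, CUP (2017), §2.6 (polarization, symmetric
  tensors spanned by powers) (key `LandsbergGCT2017`).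
-/

open MvPolynomial

namespace Literature.Computability.AlgebraicComplexity

variable {k : Type*} [Field k]

/-! ### Nonzero polynomials have nonzero values; degree of linear substitutions -/

/-- Over an infinite field a nonzero polynomial takes a nonzero value (`MvPolynomial.funext`).
[folklore] -/
theorem exists_eval_ne_zero [Infinite k] {ι : Type*} {F : MvPolynomial ι k} (hF : F ≠ 0) :
    ∃ w : ι → k, eval w F ≠ 0 := by
  by_contra h
  push Not at h
  exact hF (MvPolynomial.funext fun w => by rw [h w, map_zero])

/-- Substituting polynomials of degree `≤ 1` (affine-linear forms) does not raise the total
degree. Landsberg 2017 §1.2. [folklore] -/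
theorem totalDegree_aeval_le_of_forall_le_one {ι τ R : Type*} [CommSemiring R]
    (φ : ι → MvPolynomial τ R) (hφ : ∀ i, (φ i).totalDegree ≤ 1) (F : MvPolynomial ι R) :
    (aeval φ F).totalDegree ≤ F.totalDegree := by
  classical
  rw [F.as_sum, map_sum]
  refine (totalDegree_finsetSum _ _).trans (Finset.sup_le fun e he => ?_)
  rw [aeval_monomial, algebraMap_eq]
  refine (totalDegree_mul _ _).trans ?_
  rw [totalDegree_C, zero_add, Finsupp.prod]
  refine (totalDegree_finsetProd _ _).trans ?_
  refine le_trans (Finset.sum_le_sum fun i _ => (totalDegree_pow _ _).trans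
    (Nat.mul_le_mul_left _ (hφ i))) ?_
  simp only [mul_one]
  rw [← F.as_sum]
  exact le_totalDegree he

/-- A linear form `∑_j c_j X_j` has total degree `≤ 1`. [folklore] -/
theorem totalDegree_sum_C_mul_X_le {J R : Type*} [CommSemiring R] [Fintype J] (c : J → R) :
    (∑ j, C (c j) * X j : MvPolynomial J R).totalDegree ≤ 1 := by
  refine (totalDegree_finsetSum _ _).trans (Finset.sup_le fun j _ => ?_)
  refine (totalDegree_mul _ _).trans ?_
  rw [totalDegree_C, zero_add]
  by_cases h : Nontrivial R
  · exact (totalDegree_X (R := R) j).le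
  · rw [not_nontrivial_iff_subsingleton] at h
    rw [Subsingleton.elim (X j : MvPolynomial J R) 0, totalDegree_zero]
    exact Nat.zero_le _

/-! ### BIP Lemma 3.1: nonvanishing on a sum of few of the given vectors -/

/-- The number of variables of a monomial is at most its degree. [folklore] -/
theorem card_support_le_degree {J : Type*} (α : J →₀ ℕ) :
    α.support.card ≤ α.sum fun _ e => e := by
  rw [Finsupp.sum, Finset.card_eq_sum_ones]
  exact Finset.sum_le_sum fun j hj => Nat.one_le_iff_ne_zero.mpr (Finsupp.mem_support_iff.mp hj)

/-- **BIP Lemma 3.1 (points of low rank), coordinate form, over any infinite field.** Let `F`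
be a polynomial of total degree `≤ r` with `F(∑_j v_j) ≠ 0` for finitely many vectors `v_j`.
Then `F(∑_j t_j v_j) ≠ 0` for some coefficients `t_j` of which at most `r` are nonzero. (BIP
prove the homogeneous case with `t_j ∈ {0, 1}` by the polarization formula; here: the polynomial
`G(t) = F(∑_j t_j v_j)` is nonzero of degree `≤ r`, so has a monomial in at most `r` of the
`t_j`, and its restriction to those variables is a nonzero polynomial.)
[cite: BurgisserIkenmeyerPanovaJAMS2019, Lemma 3.1] -/
theorem exists_card_le_and_eval_sum_smul_ne_zero [Infinite k] {ι J : Type*} [Fintype J]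
    [DecidableEq J] (F : MvPolynomial ι k) {r : ℕ} (hF : F.totalDegree ≤ r) (v : J → ι → k)
    (h : eval (∑ j, v j) F ≠ 0) :
    ∃ (J₀ : Finset J) (t : J → k), J₀.card ≤ r ∧ (∀ j, j ∉ J₀ → t j = 0) ∧
      eval (∑ j, t j • v j) F ≠ 0 := by
  classical
  -- `G(t) = F(∑_j t_j v_j)` as a polynomial in `t`
  set G : MvPolynomial J k := aeval (fun i : ι => ∑ j : J, C (v j i) * X j) F with hG
  have hGeval : ∀ t : J → k, eval t G = eval (∑ j, t j • v j) F := by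
    intro t
    have hfun : (fun i : ι => aeval t (∑ j : J, C (v j i) * X j)) = ∑ j, t j • v j := by
      funext i
      simp [Finset.sum_apply, mul_comm]
    rw [hG, show eval t (aeval (fun i : ι => ∑ j : J, C (v j i) * X j) F) =
      aeval t (aeval (fun i : ι => ∑ j : J, C (v j i) * X j) F) from rfl, ← AlgHom.comp_apply,
      comp_aeval, hfun]
    rfl
  have hGdeg : G.totalDegree ≤ r :=
    (totalDegree_aeval_le_of_forall_le_one _ (fun i => totalDegree_sum_C_mul_X_le _) F).trans hF
  have hG0 : G ≠ 0 := by
    intro h0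
    apply h
    have h1 := hGeval fun _ => 1
    rw [h0, map_zero] at h1
    simp only [one_smul] at h1
    exact h1.symm
  -- a monomial `t^α` of `G`, in at most `r` variables `J₀`
  obtain ⟨α, hα⟩ := support_nonempty.mpr hG0
  set J₀ : Finset J := α.support with hJ₀
  have hJ₀r : J₀.card ≤ r := (card_support_le_degree α).trans ((le_totalDegree hα).trans hGdeg)
  -- the part `G'` of `G` in the variables `J₀`
  set S : Finset (J →₀ ℕ) := G.support.filter (fun β => β.support ⊆ J₀) with hS
  set G' : MvPolynomial J k := ∑ β ∈ S, monomial β (coeff β G) with hG'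
  have hG'0 : G' ≠ 0 := by
    intro h0
    have hc := congrArg (coeff α) h0
    rw [hG', coeff_sum, coeff_zero, Finset.sum_eq_single α] at hc
    · rw [coeff_monomial, if_pos rfl] at hc
      exact (mem_support_iff.mp hα) hc
    · intro β _ hβ
      rw [coeff_monomial, if_neg hβ]
    · intro hα'
      exact absurd (Finset.mem_filter.mpr ⟨hα, Finset.Subset.refl _⟩) hα'
  have hG'eval : ∀ t : J → k,
      eval t G' = ∑ β ∈ S, coeff β G * ∏ j ∈ β.support, t j ^ β j := by
    intro t
    rw [hG', map_sum]
    refine Finset.sum_congr rfl fun β _ => ?_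
    rw [eval_monomial, Finsupp.prod]
  -- `G = G'` at points supported on `J₀`
  have hGG' : ∀ t : J → k, (∀ j, j ∉ J₀ → t j = 0) → eval t G = eval t G' := by
    intro t ht
    rw [hG'eval, eval_eq, hS, Finset.sum_filter]
    refine Finset.sum_congr rfl fun β _ => ?_
    split_ifs with hβ
    · rfl
    · obtain ⟨j, hj, hjJ⟩ : ∃ j, j ∈ β.support ∧ j ∉ J₀ := by
        by_contra hcon
        push Not at hcon
        exact hβ hcon
      rw [Finset.prod_eq_zero hj, mul_zero]
      rw [ht j hjJ, zero_pow (Finsupp.mem_support_iff.mp hj)]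
  -- `G'` only depends on the variables `J₀`
  have hG'dep : ∀ s : J → k, eval (fun j => if j ∈ J₀ then s j else 0) G' = eval s G' := by
    intro s
    rw [hG'eval, hG'eval]
    refine Finset.sum_congr rfl fun β hβ => ?_
    obtain ⟨-, hβ⟩ := Finset.mem_filter.mp hβ
    congr 1
    refine Finset.prod_congr rfl fun j hj => ?_
    rw [if_pos (hβ hj)]
  obtain ⟨s, hs⟩ := exists_eval_ne_zero hG'0
  refine ⟨J₀, fun j => if j ∈ J₀ then s j else 0, hJ₀r, fun j hj => if_neg hj, ?_⟩
  rw [← hGeval, hGG' _ (fun j hj => if_neg hj), hG'dep]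
  exact hs


/-! ### `Sym^n V^*` is spanned by the `n`-th powers of linear forms (characteristic zero) -/

/-- Over `Finset.univ`, `∏_x X_x^{γ_x}` is the monomial `X^γ`. [folklore] -/
theorem prod_univ_X_pow_eq_monomial {σ R : Type*} [Fintype σ] [CommSemiring R] (γ : σ →₀ ℕ) :
    (∏ x, X x ^ γ x : MvPolynomial σ R) = monomial γ 1 := by
  classical
  rw [← prod_X_pow_eq_monomial]
  exact (Finset.prod_subset (Finset.subset_univ _) fun x _ hx => by
    rw [Finsupp.notMem_support_iff.mp hx, pow_zero]).symm

/-- **Multinomial expansion of a power of a linear form**: for `|β| = n`,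
`coeff_β ((∑_x Y_x X_x)^n) = multinomial(β) · ∏_x Y_x^{β_x}` (and `0` for `|β| ≠ n`).
[folklore] -/
theorem coeff_linearFormPow {σ R : Type*} [Fintype σ] [DecidableEq σ] [CommSemiring R]
    (Y : σ → R) (n : ℕ) (β : σ →₀ ℕ) :
    coeff β ((∑ x, C (Y x) * X x : MvPolynomial σ R) ^ n) =
      if β.degree = n then (Nat.multinomial Finset.univ β : R) * ∏ x, Y x ^ β x else 0 := by
  rw [Finset.sum_pow_eq_sum_piAntidiag, coeff_sum]
  have hterm : ∀ kf : σ → ℕ, ((Nat.multinomial Finset.univ kf : MvPolynomial σ R) *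
      ∏ x, (C (Y x) * X x) ^ kf x) =
      monomial (Finsupp.equivFunOnFinite.symm kf) ((Nat.multinomial Finset.univ kf : R) *
        ∏ x, Y x ^ kf x) := by
    intro kf
    rw [show monomial (Finsupp.equivFunOnFinite.symm kf)
        ((Nat.multinomial Finset.univ kf : R) * ∏ x, Y x ^ kf x) =
        C ((Nat.multinomial Finset.univ kf : R) * ∏ x, Y x ^ kf x) *
          monomial (Finsupp.equivFunOnFinite.symm kf) 1 by rw [C_mul_monomial, mul_one],
      ← prod_univ_X_pow_eq_monomial]
    simp only [Finsupp.coe_equivFunOnFinite_symm, mul_pow, Finset.prod_mul_distrib, map_mul,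
      map_natCast, map_prod, map_pow]
    ring
  simp_rw [hterm, coeff_monomial]
  have hiff : ∀ kf : σ → ℕ, Finsupp.equivFunOnFinite.symm kf = β ↔ kf = ⇑β := fun kf => by
    constructor
    · rintro rfl
      exact (Finsupp.coe_equivFunOnFinite_symm kf).symm
    · rintro rfl
      exact Finsupp.equivFunOnFinite_symm_coe β
  simp_rw [hiff]
  rw [Finset.sum_ite_eq']
  have hmem : (⇑β ∈ Finset.piAntidiag Finset.univ n) ↔ β.degree = n := by
    rw [Finset.mem_piAntidiag, Finsupp.degree_eq_sum]
    simp
  by_cases hβ : β.degree = n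
  · rw [if_pos (hmem.mpr hβ), if_pos hβ]
  · rw [if_neg (fun h => hβ (hmem.mp h)), if_neg hβ]

/-- The coefficient vector of a finite sum of polynomials is the sum of the coefficient vectors.
[folklore] -/
theorem formCoeff_sum {σ : Type*} [Fintype σ] [DecidableEq σ] {ι : Type*} (s : Finset ι) (n : ℕ)
    (P : ι → MvPolynomial σ k) : formCoeff n (∑ i ∈ s, P i) = ∑ i ∈ s, formCoeff n (P i) := by
  funext d
  simp [formCoeff_apply, coeff_sum, Finset.sum_apply]

/-- **The `n`-th powers of linear forms span `Sym^n V^*` in characteristic zero** (coordinate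
form: the coefficient vectors of the `(∑_x t_x X_x)^n`, `t ∈ k^σ`, span `k^{DegIdx σ n}`).
A linear functional vanishing on all of them has the polynomial
`t ↦ ∑_β L_β multinomial(β) t^β` vanishing identically, whence `L = 0` (`multinomial(β) ≠ 0`).
Used by BIP §3(a) ("there exist `r ∈ ℕ` and `ψ_1, …, ψ_r ∈ V^*` such that
`w = ψ_1^n + ⋯ + ψ_r^n`"). Fulton–Harris §B.2 / Landsberg 2017 §2.6 (polarization). [folklore] -/
theorem span_range_formCoeff_linearFormPow_eq_top [CharZero k] {σ : Type*} [Fintype σ]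
    [DecidableEq σ] (n : ℕ) :
    Submodule.span k (Set.range fun t : σ → k =>
      formCoeff n ((∑ x, C (t x) * X x : MvPolynomial σ k) ^ n)) = ⊤ := by
  by_contra hne
  obtain ⟨f, hf0, hf⟩ := Submodule.exists_dual_map_eq_bot_of_lt_top (lt_top_iff_ne_top.mpr hne)
    inferInstance
  have hfv : ∀ t : σ → k, f (formCoeff n ((∑ x, C (t x) * X x : MvPolynomial σ k) ^ n)) = 0 := by
    intro t
    have hm : f (formCoeff n ((∑ x, C (t x) * X x : MvPolynomial σ k) ^ n)) ∈
        (Submodule.span k (Set.range fun t : σ → k =>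
          formCoeff n ((∑ x, C (t x) * X x : MvPolynomial σ k) ^ n))).map f :=
      Submodule.mem_map_of_mem (Submodule.subset_span ⟨t, rfl⟩)
    rw [hf] at hm
    exact (Submodule.mem_bot k).mp hm
  -- expansion of `f` in the coordinate functionals
  have hfexp : ∀ w : DegIdx σ n → k, f w = ∑ d, w d * f (Pi.single d 1) := by
    intro w
    have hw : w = ∑ d, w d • (Pi.single d (1 : k) : DegIdx σ n → k) := by
      funext i
      simp only [Finset.sum_apply, Pi.smul_apply, Pi.single_apply, smul_eq_mul, mul_ite, mul_one,
        mul_zero, Finset.sum_ite_eq, Finset.mem_univ, if_true]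
    conv_lhs => rw [hw]
    rw [map_sum]
    refine Finset.sum_congr rfl fun d _ => ?_
    rw [map_smul, smul_eq_mul]
  -- the polynomial `QP(Y) = f(coeff vector of (∑_x Y_x X_x)^n)` in the variables `Y = σ`
  set Λ : MvPolynomial σ (MvPolynomial σ k) := ∑ x, C (X x) * X x with hΛ
  set QP : MvPolynomial σ k := ∑ d : DegIdx σ n, f (Pi.single d 1) • coeff d.1 (Λ ^ n) with hQP
  have hQPeval : ∀ t : σ → k,
      eval t QP = f (formCoeff n ((∑ x, C (t x) * X x : MvPolynomial σ k) ^ n)) := by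
    intro t
    rw [hfexp, hQP, map_sum]
    refine Finset.sum_congr rfl fun d _ => ?_
    rw [smul_eq_C_mul, map_mul, eval_C, mul_comm]
    congr 1
    rw [formCoeff_apply, ← coeff_map, map_pow, hΛ, map_sum]
    congr 2
    refine Finset.sum_congr rfl fun x _ => ?_
    rw [map_mul, map_C, map_X, eval_X]
  have hQP0 : QP = 0 := MvPolynomial.funext fun t => by rw [hQPeval, hfv, map_zero]
  -- read off the coefficient of `Y^d`
  have hcoeffQP : ∀ d : DegIdx σ n,
      coeff d.1 QP = f (Pi.single d 1) * (Nat.multinomial Finset.univ d.1 : k) := by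
    intro d
    rw [hQP, coeff_sum]
    have h1 : ∀ e : DegIdx σ n, coeff d.1 (f (Pi.single e 1) • coeff e.1 (Λ ^ n)) =
        if e = d then f (Pi.single d 1) * (Nat.multinomial Finset.univ d.1 : k) else 0 := by
      intro e
      rw [coeff_smul, hΛ, coeff_linearFormPow, if_pos (mem_degMonomials_iff.mp e.2),
        prod_univ_X_pow_eq_monomial, smul_eq_mul]
      rw [show ((Nat.multinomial Finset.univ e.1 : MvPolynomial σ k)) =
        C (Nat.multinomial Finset.univ e.1 : k) from (map_natCast C _).symm, C_mul_monomial,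
        mul_one, coeff_monomial]
      by_cases hed : e = d
      · subst hed
        rw [if_pos rfl, if_pos rfl]
      · rw [if_neg (fun h => hed (Subtype.ext h)), if_neg hed, mul_zero]
    simp_rw [h1]
    rw [Finset.sum_ite_eq', if_pos (Finset.mem_univ _)]
  have hfd : ∀ d : DegIdx σ n, f (Pi.single d 1) = 0 := by
    intro d
    have h := hcoeffQP d
    rw [hQP0, coeff_zero] at h
    exact (mul_eq_zero.mp h.symm).resolve_right
      (Nat.cast_ne_zero.mpr (Nat.multinomial_pos _ _).ne')
  apply hf0
  refine LinearMap.ext fun w => ?_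
  rw [hfexp w, LinearMap.zero_apply]
  exact Finset.sum_eq_zero fun d _ => by rw [hfd, mul_zero]

/-- Every degree-`n` coefficient vector is a finite linear combination of coefficient vectors of
`n`-th powers of linear forms (characteristic zero). [folklore] -/
theorem exists_finsupp_sum_formCoeff_linearFormPow_eq [CharZero k] {σ : Type*} [Fintype σ]
    [DecidableEq σ] (n : ℕ) (w : DegIdx σ n → k) :
    ∃ c : (σ → k) →₀ k,
      (c.sum fun t a => a • formCoeff n ((∑ x, C (t x) * X x : MvPolynomial σ k) ^ n)) = w := by
  apply Finsupp.mem_span_range_iff_exists_finsupp.mp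
  rw [span_range_formCoeff_linearFormPow_eq_top]
  exact Submodule.mem_top

/-! ### BIP Prop. 3.2: nonzero forms do not vanish on power sums with few terms -/

/-- Padding a family indexed by `Fin r'`, `r' ≤ r`, by zeros to a family indexed by `Fin r` does
not change a sum of terms vanishing at the padding value. [folklore] -/
theorem sum_fin_pad_eq {M : Type*} [AddCommMonoid M] {α : Type*} {r' r : ℕ} (h : r' ≤ r)
    (u : Fin r' → α) (a₀ : α) (g : α → M) (hg : g a₀ = 0) :
    ∑ i : Fin r, g (if hi : (i : ℕ) < r' then u ⟨i, hi⟩ else a₀) = ∑ i : Fin r', g (u i) := by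
  have hR : ∑ i : Fin r', g (u i) =
      ∑ m ∈ Finset.range r', g (if hi : m < r' then u ⟨m, hi⟩ else a₀) := by
    rw [← Fin.sum_univ_eq_sum_range (fun m => g (if hi : m < r' then u ⟨m, hi⟩ else a₀)) r']
    refine Finset.sum_congr rfl fun i _ => ?_
    rw [dif_pos i.2]
  rw [Fin.sum_univ_eq_sum_range (fun m => g (if hi : m < r' then u ⟨m, hi⟩ else a₀)) r, hR]
  refine (Finset.sum_subset (Finset.range_subset_range.mpr h) fun m _ hm => ?_).symm
  rw [dif_neg (by simpa using hm), hg]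

/-- **BIP Prop. 3.2, coefficient form, over any field of characteristic zero.** A nonzero
polynomial `F` of degree `≤ r` on `Sym^n V^*` (i.e. in the degree-`n` coefficients) does not
vanish at some power sum `∑_{i<r} a_i φ_i^n` of `r` terms (with coefficients `a_i`; zero terms
allowed). (`F(w) ≠ 0` somewhere; `w` is a combination of `n`-th powers of linear forms,
`exists_finsupp_sum_formCoeff_linearFormPow_eq`; reduce to `≤ r` of them by Lemma 3.1,
`exists_card_le_and_eval_sum_smul_ne_zero`.) [cite: BurgisserIkenmeyerPanovaJAMS2019, Prop. 3.2] -/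
theorem exists_aeval_formCoeff_sum_C_mul_linearFormPow_ne_zero [CharZero k] {σ : Type*}
    [Fintype σ] [DecidableEq σ] {n r : ℕ} (F : MvPolynomial (DegIdx σ n) k) (hF : F ≠ 0)
    (hFr : F.totalDegree ≤ r) :
    ∃ (a : Fin r → k) (φ : Fin r → σ → k),
      aeval (formCoeff n (∑ i, C (a i) * (∑ x, C (φ i x) * X x : MvPolynomial σ k) ^ n)) F ≠ 0 := by
  classical
  obtain ⟨w, hw⟩ := exists_eval_ne_zero hF
  obtain ⟨c, hc⟩ := exists_finsupp_sum_formCoeff_linearFormPow_eq n w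
  -- the finitely many powers `v_j = c_j ψ_j^n`, `j ∈ supp c`
  set v : c.support → (DegIdx σ n → k) := fun j =>
    c j • formCoeff n ((∑ x, C (j.1 x) * X x : MvPolynomial σ k) ^ n) with hv
  have hsum : ∑ j, v j = w := by
    rw [← hc, Finsupp.sum, hv]
    exact Finset.sum_coe_sort c.support
      (fun t => c t • formCoeff n ((∑ x, C (t x) * X x : MvPolynomial σ k) ^ n))
  obtain ⟨J₀, t, hJ₀r, ht0, hne⟩ :=
    exists_card_le_and_eval_sum_smul_ne_zero F hFr v (by rwa [hsum])
  -- enumerate `J₀` and pad to `r` terms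
  set e := J₀.equivFin with he
  set ψ : Fin J₀.card → σ → k := fun i => ((e.symm i : J₀) : c.support).1 with hψ
  set b : Fin J₀.card → k := fun i => t (e.symm i) * c ((e.symm i : J₀) : c.support).1 with hb
  have hpoint : ∑ j, t j • v j =
      formCoeff n (∑ i : Fin J₀.card, C (b i) * (∑ x, C (ψ i x) * X x : MvPolynomial σ k) ^ n) := by
    rw [formCoeff_sum, ← Finset.sum_subset (Finset.subset_univ J₀) fun j _ hj => by
      rw [ht0 j hj, zero_smul], ← Finset.sum_coe_sort J₀,
      ← Fintype.sum_equiv e.symm _ _ (fun i => rfl)]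
    refine Finset.sum_congr rfl fun i _ => ?_
    rw [hv]
    simp only [hb, hψ]
    rw [C_mul', formCoeff_smul, smul_smul]
  refine ⟨fun i => if hi : (i : ℕ) < J₀.card then b ⟨i, hi⟩ else 0,
    fun i => if hi : (i : ℕ) < J₀.card then ψ ⟨i, hi⟩ else 0, ?_⟩
  have hpad : (∑ i : Fin r, C (if hi : (i : ℕ) < J₀.card then b ⟨i, hi⟩ else 0) *
      (∑ x, C ((if hi : (i : ℕ) < J₀.card then ψ ⟨i, hi⟩ else (0 : σ → k)) x) * X x :
        MvPolynomial σ k) ^ n) =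
      ∑ i : Fin J₀.card, C (b i) * (∑ x, C (ψ i x) * X x : MvPolynomial σ k) ^ n := by
    have hpad0 := sum_fin_pad_eq (M := MvPolynomial σ k) hJ₀r (fun i => (b i, ψ i))
      ((0 : k), (0 : σ → k))
      (fun p : k × (σ → k) => C p.1 * (∑ x, C (p.2 x) * X x : MvPolynomial σ k) ^ n)
      (by simp)
    refine Eq.trans (Finset.sum_congr rfl fun i _ => ?_) hpad0
    by_cases hi : (i : ℕ) < J₀.card
    · simp [hi]
    · simp [hi]
  rw [hpad, ← hpoint]
  exact hne

/-- **BIP Prop. 3.2 (nonvanishing on power sums), over an algebraically closed field of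
characteristic zero.** "Let `V` be a finite dimensional `ℂ`-vector space and `d, n ≥ 1`. If
`f ∈ Sym^d Sym^n V` is nonzero, then `⟨f, (φ_1^n + ⋯ + φ_d^n)^d⟩ ≠ 0` for Zariski almost all
`(φ_1, …, φ_d) ∈ (V^*)^d`." Here: a nonzero polynomial `F` of degree `≤ r` in the degree-`n`
coefficients (`n ≥ 1`) does not vanish at the coefficient vector of some power sum
`∑_{i<r} φ_i^n` with `r` terms (the coefficients of the previous theorem are `n`-th powers). The
"Zariski almost all" strengthening is `exists_aeval_formCoeff_sum_linearFormPow_ne_zero_and`.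
[cite: BurgisserIkenmeyerPanovaJAMS2019, Prop. 3.2] -/
theorem exists_aeval_formCoeff_sum_linearFormPow_ne_zero [IsAlgClosed k] [CharZero k]
    {σ : Type*} [Fintype σ] [DecidableEq σ] {n r : ℕ} (hn : 0 < n)
    (F : MvPolynomial (DegIdx σ n) k) (hF : F ≠ 0) (hFr : F.totalDegree ≤ r) :
    ∃ φ : Fin r → σ → k,
      aeval (formCoeff n (∑ i, (∑ x, C (φ i x) * X x : MvPolynomial σ k) ^ n)) F ≠ 0 := by
  obtain ⟨a, φ, h⟩ := exists_aeval_formCoeff_sum_C_mul_linearFormPow_ne_zero F hF hFr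
  choose b hb using fun i => IsAlgClosed.exists_pow_nat_eq (a i) hn
  refine ⟨fun i x => b i * φ i x, ?_⟩
  have heq : (∑ i, (∑ x, C ((fun i x => b i * φ i x) i x) * X x : MvPolynomial σ k) ^ n) =
      ∑ i, C (a i) * (∑ x, C (φ i x) * X x : MvPolynomial σ k) ^ n := by
    refine Finset.sum_congr rfl fun i _ => ?_
    rw [← hb i, map_pow, ← mul_pow, Finset.mul_sum]
    congr 2
    funext x
    rw [map_mul, mul_assoc]
  rw [heq]
  exact h


/-! ### Genericity: two nonzero forms have a common good power sum -/

/-- The *generic power sum* with `r` terms of degree `n`, `∑_{i<r} (∑_x Y_{(i,x)} X_x)^n`, a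
polynomial in `X` over the polynomial ring in the coefficients `Y`: specialising `Y` to `φ'`
gives the power sum of the linear forms `φ_i = ∑_x φ'(i,x) X_x`. [folklore] -/
theorem map_eval_genericPowerSum {σ : Type*} [Fintype σ] (r n : ℕ) (φ' : Fin r × σ → k) :
    map (eval φ') (∑ i : Fin r,
      (∑ x, C (X (i, x)) * X x : MvPolynomial σ (MvPolynomial (Fin r × σ) k)) ^ n) =
      ∑ i : Fin r, (∑ x, C (φ' (i, x)) * X x : MvPolynomial σ k) ^ n := by
  simp only [map_sum, map_pow, map_mul, map_C, map_X, eval_X]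

/-- Pulling a polynomial `F` on `Sym^n V^*` back along the generic power sum gives a polynomial
in the coefficients `Y` whose value at `φ'` is `F` at the power sum of the `φ_i`. [folklore] -/
theorem eval_aeval_coeff_genericPowerSum {σ : Type*} [Fintype σ] [DecidableEq σ] (r n : ℕ)
    (F : MvPolynomial (DegIdx σ n) k) (φ' : Fin r × σ → k) :
    eval φ' (aeval (fun d : DegIdx σ n => coeff d.1 (∑ i : Fin r,
      (∑ x, C (X (i, x)) * X x : MvPolynomial σ (MvPolynomial (Fin r × σ) k)) ^ n)) F) =
      aeval (formCoeff n (∑ i : Fin r, (∑ x, C (φ' (i, x)) * X x : MvPolynomial σ k) ^ n)) F := by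
  rw [show eval φ' (aeval (fun d : DegIdx σ n => coeff d.1 (∑ i : Fin r,
      (∑ x, C (X (i, x)) * X x : MvPolynomial σ (MvPolynomial (Fin r × σ) k)) ^ n)) F) =
      aeval φ' (aeval (fun d : DegIdx σ n => coeff d.1 (∑ i : Fin r,
      (∑ x, C (X (i, x)) * X x : MvPolynomial σ (MvPolynomial (Fin r × σ) k)) ^ n)) F) from rfl,
    ← AlgHom.comp_apply, comp_aeval]
  have hfun : (fun d : DegIdx σ n => aeval φ' (coeff d.1 (∑ i : Fin r,
      (∑ x, C (X (i, x)) * X x : MvPolynomial σ (MvPolynomial (Fin r × σ) k)) ^ n))) =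
      formCoeff n (∑ i : Fin r, (∑ x, C (φ' (i, x)) * X x : MvPolynomial σ k) ^ n) := by
    funext d
    rw [formCoeff_apply, ← map_eval_genericPowerSum r n φ', coeff_map]
    rfl
  rw [hfun]

/-- **BIP Prop. 3.2, "Zariski almost all" form: two nonzero forms have a common good power sum.**
If `F₁, F₂` are nonzero polynomials of degree `≤ r` in the degree-`n` coefficients (`n ≥ 1`,
algebraically closed field of characteristic zero), some power sum `∑_{i<r} φ_i^n` is a non-zero
of both (each non-vanishing set is a nonempty Zariski open subset of `(V^*)^r`, BIP: "the open
set ... is nonempty and hence Zariski dense"; here: the product of the two pulled-back polynomials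
on `(V^*)^r` is nonzero). Used in BIP's proof of Prop. 6.1 ("there are `φ_1, …, φ_k` such that
`⟨g, Δ(p)^k⟩ ≠ 0` and `⟨e_1^s, Δ(p)⟩ ≠ 0`"). [cite: BurgisserIkenmeyerPanovaJAMS2019, Prop. 3.2] -/
theorem exists_aeval_formCoeff_sum_linearFormPow_ne_zero_and [IsAlgClosed k] [CharZero k]
    {σ : Type*} [Fintype σ] [DecidableEq σ] {n r : ℕ} (hn : 0 < n)
    (F₁ F₂ : MvPolynomial (DegIdx σ n) k) (h₁ : F₁ ≠ 0) (h₂ : F₂ ≠ 0)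
    (hr₁ : F₁.totalDegree ≤ r) (hr₂ : F₂.totalDegree ≤ r) :
    ∃ φ : Fin r → σ → k,
      aeval (formCoeff n (∑ i, (∑ x, C (φ i x) * X x : MvPolynomial σ k) ^ n)) F₁ ≠ 0 ∧
      aeval (formCoeff n (∑ i, (∑ x, C (φ i x) * X x : MvPolynomial σ k) ^ n)) F₂ ≠ 0 := by
  -- the pulled-back polynomials on `(V^*)^r` are nonzero
  have hP0 : ∀ F : MvPolynomial (DegIdx σ n) k, F ≠ 0 → F.totalDegree ≤ r →
      aeval (fun d : DegIdx σ n => coeff d.1 (∑ i : Fin r,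
        (∑ x, C (X (i, x)) * X x : MvPolynomial σ (MvPolynomial (Fin r × σ) k)) ^ n)) F ≠ 0 := by
    intro F hF hFr hzero
    obtain ⟨φ, hφ⟩ := exists_aeval_formCoeff_sum_linearFormPow_ne_zero hn F hF hFr
    apply hφ
    have h := eval_aeval_coeff_genericPowerSum r n F (fun ix => φ ix.1 ix.2)
    rw [hzero, map_zero] at h
    exact h.symm
  obtain ⟨φ', hφ'⟩ := exists_eval_ne_zero (mul_ne_zero (hP0 F₁ h₁ hr₁) (hP0 F₂ h₂ hr₂))
  rw [map_mul] at hφ'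
  refine ⟨fun i x => φ' (i, x), ?_, ?_⟩
  · have h := left_ne_zero_of_mul hφ'
    rwa [eval_aeval_coeff_genericPowerSum] at h
  · have h := right_ne_zero_of_mul hφ'
    rwa [eval_aeval_coeff_genericPowerSum] at h

end Literature.Computability.AlgebraicComplexity
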